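import Literature.NumberTheory.EllipticCurves.SelmerCorankProofs
import HarnessLib

/-!
# Greenberg–Vatsal 2000, §2 display (16) — devissage modules: a `G`-stable subgroup `Φ ≤ M` of a
# discrete `G`-module as a discrete `G`-module, and the quotient `M ⧸ Φ` (generic plumbing)

HONEST FRAMING (cell `b2b-bsdres`, run/shared/lean/b2b/bsd-rank1-residual/, verbatim in every
file): the goal of the cell is to DELETE the COMBINATION-SHAPED residual classes of the
Birch–Swinnerton-Dyer formula for ALL analytic-rank `≤ 1` elliptic curves over `ℚ` — "full BSD
formula for every rank `≤ 1` curve in class `C`" assembled STRICTLY from published theorems — so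
that the rank-`≤ 1` remainder becomes exactly the CONSTRUCTION-SHAPED classes, which are TYPED
(missing-input `Prop`s), NOT attempted. This is not "finishing BSD". Sub-cell
`b2b-bsdres-eisenstein-p2` (CLASS-OWNERS row "X2"), gen 16: research route; NO CLAIM BEYOND STATED
CLASSES; nothing here changes a label; no named fact; every `def` has a body. GENERIC algebra.

WHY. The kernel devissage of Greenberg–Vatsal's display (16)
(`X2/ResidualDevissage.lean`, `X2/ResidualDevissageSelmer.lean`: `#S^{Σ₀}_M(L) = #H¹(ℚ_Σ/L, Φ) ·
#S^{Σ₀}_Ψ(L)` for `0 → Φ → M → Ψ → 0`) is stated for abstract discrete `Γ_K`-modules `Φ`, `Ψ` with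
equivariant maps. To instantiate it on `M = E[p]` with `Φ = C[p]` the RAMIFIED-EVEN RATIONAL LINE
(GV p. 28: "`E[p]` contains a `G_ℚ`-invariant subgroup `Φ` … `Ψ = E[p]/Φ`") one needs the
sub-object `Φ` and the quotient `E[p]/Φ` as discrete `Γ_ℚ`-modules in the tree's sense
(`DistribMulAction` + discrete topology + continuous orbit maps). Mathlib has no bundled
"`G`-stable additive subgroup" with these instances (the tree's `GreenbergSelmer.LocalDatum.Gr`
does the quotient for the decomposition group only); this file supplies them once, generically.

CONTENT. `StableSubgroup G M` (an `AddSubgroup` closed under the action); `S.Sub = ↥S` and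
`S.Quot = M ⧸ S` as types with `AddCommGroup`, discrete topology and `DistribMulAction G`
instances; the equivariant maps `S.incl : S.Sub →+ M` (injective), `S.proj : M →+ S.Quot`
(surjective), exactness `S.proj ∘ S.incl = 0`, `ker S.proj = im S.incl`; continuity of orbit maps
(`continuous_smul_sub`, `continuous_smul_quot`); the action read on representatives (`smul_proj`,
`coe_smul_sub`); and `smul_quot_eq_neg_iff` / `smul_sub_eq_self_iff` (an element acts as `−1` on
`M ⧸ S` iff `g • m + m ∈ S` for all `m`; trivially on `S.Sub` iff it fixes `S` pointwise).

References: Greenberg–Vatsal, Invent. Math. 142 (2000) = arXiv:math/9906215, §2 p. 28;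
Serre, *Galois Cohomology* I.§2.2. [folklore throughout]
-/

noncomputable section

open scoped Classical

universe u

namespace Summit.BirchSwinnertonDyer.Rank1Residual.X2.ResidualDevissageModules

open Literature.NumberTheory.EllipticCurves

variable (G : Type u) [Group G] (M : Type u) [AddCommGroup M] [DistribMulAction G M]

/-- A **`G`-stable subgroup** of the `G`-module `M` (GV p. 28: "a `G_ℚ`-invariant subgroup `Φ`").
[cite: GreenbergVatsal2000, §2 p. 28] -/
structure StableSubgroup where
  /-- The underlying additive subgroup. -/
  toAddSubgroup : AddSubgroup M
  /-- Stability under the action. -/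
  smul_mem' : ∀ (g : G) {m : M}, m ∈ toAddSubgroup → g • m ∈ toAddSubgroup

namespace StableSubgroup

variable {G M} (S : StableSubgroup G M)

/-! ## §1. The sub-module `Φ = ↥S` -/

/-- The stable subgroup as a TYPE (to carry its own module and topology instances). [folklore] -/
def Sub : Type u := ↥S.toAddSubgroup

/-- `↥S` is an abelian group. [folklore] -/
instance instAddCommGroupSub : AddCommGroup S.Sub :=
  inferInstanceAs (AddCommGroup ↥S.toAddSubgroup)

/-- `↥S` carries the discrete topology. [folklore] -/
instance instTopologicalSpaceSub : TopologicalSpace S.Sub := ⊥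

/-- `↥S` is discrete. [folklore] -/
instance instDiscreteTopologySub : DiscreteTopology S.Sub := ⟨rfl⟩

/-- The restricted action of `G` on `↥S`. [folklore] -/
instance instDistribMulActionSub : DistribMulAction G S.Sub where
  smul g x := ⟨g • (x : ↥S.toAddSubgroup).1, S.smul_mem' g x.2⟩
  one_smul x := Subtype.ext (one_smul G (x : ↥S.toAddSubgroup).1)
  mul_smul g h x := Subtype.ext (mul_smul g h (x : ↥S.toAddSubgroup).1)
  smul_zero g := Subtype.ext (smul_zero g)
  smul_add g x y := Subtype.ext (smul_add g (x : ↥S.toAddSubgroup).1 (y : ↥S.toAddSubgroup).1)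

/-- The inclusion `i : ↥S → M`. [folklore] -/
def incl : S.Sub →+ M := S.toAddSubgroup.subtype

/-- Unfolding the action on `↥S`: `i (g • x) = g • i x`. [folklore] -/
@[simp]
theorem incl_smul (g : G) (x : S.Sub) : S.incl (g • x) = g • S.incl x := rfl

/-- `incl_smul` in the form consumed by `resH1Hom (ContinuousMonoidHom.id G)`. [folklore] -/
theorem incl_smul_id [TopologicalSpace G] (g : G) (x : S.Sub) :
    S.incl (ContinuousMonoidHom.id G g • x) = g • S.incl x := rfl

/-- `i` is injective. [folklore] -/
theorem incl_injective : Function.Injective S.incl := Subtype.val_injective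

/-- The image of `i` is `S`. [folklore] -/
theorem range_incl : S.incl.range = S.toAddSubgroup := AddSubgroup.range_subtype _

/-- Orbit maps of `↥S` are continuous when those of `M` are (`M` discrete). [folklore] -/
theorem continuous_smul_sub [TopologicalSpace G] [TopologicalSpace M] [DiscreteTopology M]
    (hM : ∀ m : M, Continuous fun g : G ↦ g • m) (x : S.Sub) :
    Continuous fun g : G ↦ g • x :=
  continuous_of_injective_comp (ι := S.incl) S.incl_injective (hM (S.incl x))

/-- `g` fixes `↥S` pointwise iff it fixes every element of `S`. [folklore] -/
theorem forall_smul_sub_eq_self_iff (g : G) :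
    (∀ x : S.Sub, g • x = x) ↔ ∀ m ∈ S.toAddSubgroup, g • m = m := by
  constructor
  · intro h m hm
    exact congrArg S.incl (h ⟨m, hm⟩)
  · intro h x
    exact S.incl_injective (h _ x.2)

/-! ## §2. The quotient module `Ψ = M ⧸ S` -/

/-- The quotient `M ⧸ S` as a TYPE (GV's `Ψ = E[p]/Φ`). [cite: GreenbergVatsal2000, §2 p. 28] -/
def Quot : Type u := M ⧸ S.toAddSubgroup

/-- `M ⧸ S` is an abelian group. [folklore] -/
instance instAddCommGroupQuot : AddCommGroup S.Quot :=
  inferInstanceAs (AddCommGroup (M ⧸ S.toAddSubgroup))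

/-- `M ⧸ S` carries the discrete topology. [folklore] -/
instance instTopologicalSpaceQuot : TopologicalSpace S.Quot := ⊥

/-- `M ⧸ S` is discrete. [folklore] -/
instance instDiscreteTopologyQuot : DiscreteTopology S.Quot := ⟨rfl⟩

/-- The projection `q : M → M ⧸ S`. [folklore] -/
def proj : M →+ S.Quot := QuotientAddGroup.mk' S.toAddSubgroup

/-- `q` is surjective. [folklore] -/
theorem proj_surjective : Function.Surjective S.proj := QuotientAddGroup.mk'_surjective _

/-- `ker q = S`. [folklore] -/
theorem ker_proj : S.proj.ker = S.toAddSubgroup := QuotientAddGroup.ker_mk' _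

/-- The endomorphism of `M ⧸ S` induced by `g ∈ G` (well defined by stability). [folklore] -/
def quotSMulHom (g : G) : S.Quot →+ S.Quot :=
  QuotientAddGroup.map S.toAddSubgroup S.toAddSubgroup (DistribSMul.toAddMonoidHom M g)
    fun _ hm ↦ S.smul_mem' g hm

/-- `quotSMulHom g` on classes. [folklore] -/
@[simp]
theorem quotSMulHom_proj (g : G) (m : M) : S.quotSMulHom g (S.proj m) = S.proj (g • m) := rfl

/-- The **action of `G` on `M ⧸ S`**. [folklore] -/
instance instDistribMulActionQuot : DistribMulAction G S.Quot where
  smul g y := S.quotSMulHom g y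
  one_smul y := by
    obtain ⟨m, rfl⟩ := S.proj_surjective y
    change S.quotSMulHom 1 (S.proj m) = S.proj m
    rw [quotSMulHom_proj, one_smul]
  mul_smul g h y := by
    obtain ⟨m, rfl⟩ := S.proj_surjective y
    change S.quotSMulHom (g * h) (S.proj m) = S.quotSMulHom g (S.quotSMulHom h (S.proj m))
    rw [quotSMulHom_proj, quotSMulHom_proj, quotSMulHom_proj, mul_smul]
  smul_zero g := map_zero (S.quotSMulHom g)
  smul_add g x y := map_add (S.quotSMulHom g) x y

/-- Unfolding the action on classes: `g • q m = q (g • m)`. [folklore] -/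
@[simp]
theorem smul_proj (g : G) (m : M) : g • S.proj m = S.proj (g • m) := rfl

/-- `q` is equivariant, in the form consumed by `resH1Hom (ContinuousMonoidHom.id G)`. [folklore] -/
theorem proj_smul_id [TopologicalSpace G] (g : G) (m : M) :
    S.proj (ContinuousMonoidHom.id G g • m) = g • S.proj m := rfl

/-- `q` is equivariant. [folklore] -/
theorem proj_smul (g : G) (m : M) : S.proj (g • m) = g • S.proj m := rfl

/-- `q ∘ i = 0`. [folklore] -/
theorem proj_incl (x : S.Sub) : S.proj (S.incl x) = 0 := by
  rw [← AddMonoidHom.mem_ker, ker_proj]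
  exact x.2

/-- Exactness at `M`: `ker q ⊆ im i`. [folklore] -/
theorem mem_range_incl_of_proj_eq_zero (m : M) (hm : S.proj m = 0) : m ∈ S.incl.range := by
  rw [range_incl, ← ker_proj]
  exact hm

/-- Orbit maps of `M ⧸ S` are continuous when those of `M` are. [folklore] -/
theorem continuous_smul_quot [TopologicalSpace G] [TopologicalSpace M] [DiscreteTopology M]
    (hM : ∀ m : M, Continuous fun g : G ↦ g • m) (y : S.Quot) :
    Continuous fun g : G ↦ g • y := by
  obtain ⟨m, rfl⟩ := S.proj_surjective y
  simp_rw [smul_proj]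
  exact continuous_of_discreteTopology.comp (hM m)

/-- `g` acts as `−1` on `M ⧸ S` iff `g • m + m ∈ S` for every `m`. [folklore] -/
theorem forall_smul_quot_eq_neg_iff (g : G) :
    (∀ y : S.Quot, g • y = -y) ↔ ∀ m : M, g • m + m ∈ S.toAddSubgroup := by
  constructor
  · intro h m
    have := h (S.proj m)
    rw [smul_proj, ← add_eq_zero_iff_eq_neg, ← map_add, ← AddMonoidHom.mem_ker, ker_proj] at this
    exact this
  · intro h y
    obtain ⟨m, rfl⟩ := S.proj_surjective y
    rw [smul_proj, ← add_eq_zero_iff_eq_neg, ← map_add, ← AddMonoidHom.mem_ker, ker_proj]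
    exact h m

/-- `g` fixes `M ⧸ S` pointwise iff `g • m - m ∈ S` for every `m`. [folklore] -/
theorem forall_smul_quot_eq_self_iff (g : G) :
    (∀ y : S.Quot, g • y = y) ↔ ∀ m : M, g • m - m ∈ S.toAddSubgroup := by
  constructor
  · intro h m
    have := h (S.proj m)
    rw [smul_proj, ← sub_eq_zero, ← map_sub, ← AddMonoidHom.mem_ker, ker_proj] at this
    exact this
  · intro h y
    obtain ⟨m, rfl⟩ := S.proj_surjective y
    rw [smul_proj, ← sub_eq_zero, ← map_sub, ← AddMonoidHom.mem_ker, ker_proj]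
    exact h m

/-- `n • (M ⧸ S) = 0` when `n • M = 0`. [folklore] -/
theorem nsmul_quot_eq_zero {n : ℕ} (hn : ∀ m : M, n • m = 0) (y : S.Quot) : n • y = 0 := by
  obtain ⟨m, rfl⟩ := S.proj_surjective y
  rw [← map_nsmul, hn, map_zero]

/-- Cardinalities: `#M = #S · #(M ⧸ S)` (Lagrange). [folklore] -/
theorem natCard_eq_mul : Nat.card M = Nat.card S.Quot * Nat.card S.Sub :=
  S.toAddSubgroup.card_eq_card_quotient_mul_card_addSubgroup

end StableSubgroup

end Summit.BirchSwinnertonDyer.Rank1Residual.X2.ResidualDevissageModules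

end
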